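import Mathlib
import Literature.Computability.AlgebraicComplexity.DivisionSLP
import Literature.LinearAlgebra.Matrix.CauchyLike

/-!
# Auxiliary lemmas for stub `stub_mba` of crux `HiddenToeplitzCorners.ToeplitzLikeDetCost`
# (stmt-MatrixMultiplication-7491), line `Sketch`

Cost-model plumbing for the Morf / Bitmead–Anderson divide and conquer on Cauchy-like matrices:
entrywise derivability of matrix products from matrix–vector products, of differences and
negations, the parity splitting `Fin (2^κ) ⊕ Fin (2^κ) ≃ Fin (2^(κ+1))`, the transfer of the
principal-minor hypothesis to the leading block and to its Schur complement, the target
identification along an index equivalence, and the abstract block-inverse assembly step.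

Target tree file (directory `Summits/MatrixMultiplication/MatrixMultiplication/Theorems/`):
`HiddenToeplitzCornersToeplitzLikeDetCostMBAAux.lean`.
-/

set_option linter.dupNamespace false

namespace Summit.MatrixMultiplication.MatrixMultiplication.Theorems

open scoped BigOperators Matrix
open Literature.Computability.AlgebraicComplexity Literature.LinearAlgebra.Matrix

noncomputable section

section KLevel
variable {K : Type} [Field K] [Algebra ℂ K]

/-- Accumulating transitivity: derive `B` from `A`, then `C` from `A ∪ B`; both stay available.
[folklore] -/
theorem mba_snoc {m n : ℕ} {A B C : Set K} (h₁ : Derivable ℂ m A B)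
    (h₂ : Derivable ℂ n (A ∪ B) C) : Derivable ℂ (m + n) A (B ∪ C) := by
  have h := h₁.trans ((Derivable.of_subset (k := ℂ) (A := A ∪ B) (B := B)
    (fun x hx => Or.inl (Or.inr hx)) 0).union h₂)
  exact h.mono (by omega) Set.Subset.rfl Set.Subset.rfl

/-- A finite family of single steps gives its range at cost the cardinality of the index type.
[folklore] -/
theorem mba_family {ι : Type} [Fintype ι] {S : Set K} {f : ι → K}
    (h : ∀ i, Derivable ℂ 1 S {f i}) : Derivable ℂ (Fintype.card ι) S (Set.range f) := by
  classical
  have := Derivable.biUnion (k := ℂ) (Finset.univ : Finset ι) (c := fun _ => 1) (A := S)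
    (B := fun i => ({f i} : Set K)) (fun i _ => h i)
  refine this.mono (by simp) Set.Subset.rfl ?_
  rintro _ ⟨i, rfl⟩
  exact Set.mem_iUnion₂.2 ⟨i, Finset.mem_univ i, Set.mem_singleton (f i)⟩

/-- Entries of a matrix product `M * N`, column by column from matrix–vector products with `M`.
[folklore] -/
theorem mba_mulRight {m n p : Type} [Fintype n] [Fintype p] (M : Matrix m n K)
    (N : Matrix n p K) {S : Set K} {c : ℕ}
    (hM : ∀ v : n → K, (∀ j, v j ∈ S ∪ Set.range (algebraMap ℂ K)) →
      Derivable ℂ c S (Set.range (M.mulVec v)))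
    (hN : ∀ j k, N j k ∈ S ∪ Set.range (algebraMap ℂ K)) :
    Derivable ℂ (Fintype.card p * c) S (Set.range fun ik : m × p => (M * N) ik.1 ik.2) := by
  classical
  have h := Derivable.biUnion (k := ℂ) (Finset.univ : Finset p) (c := fun _ => c) (A := S)
    (B := fun k => Set.range (M.mulVec fun j => N j k)) (fun k _ => hM _ (fun j => hN j k))
  refine h.mono (by simp) Set.Subset.rfl ?_
  rintro _ ⟨⟨i, k⟩, rfl⟩
  exact Set.mem_iUnion₂.2 ⟨k, Finset.mem_univ k, i, by simp [Matrix.mul_apply, Matrix.mulVec,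
    dotProduct]⟩

/-- Entries of a matrix product `N * M`, row by row from vector–matrix products with `M`.
[folklore] -/
theorem mba_mulLeft {m n p : Type} [Fintype m] [Fintype p] (N : Matrix p m K)
    (M : Matrix m n K) {S : Set K} {c : ℕ}
    (hM : ∀ v : m → K, (∀ i, v i ∈ S ∪ Set.range (algebraMap ℂ K)) →
      Derivable ℂ c S (Set.range (Matrix.vecMul v M)))
    (hN : ∀ k i, N k i ∈ S ∪ Set.range (algebraMap ℂ K)) :
    Derivable ℂ (Fintype.card p * c) S (Set.range fun kj : p × n => (N * M) kj.1 kj.2) := by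
  classical
  have h := Derivable.biUnion (k := ℂ) (Finset.univ : Finset p) (c := fun _ => c) (A := S)
    (B := fun k => Set.range (Matrix.vecMul (fun i => N k i) M)) (fun k _ => hM _ (fun i => hN k i))
  refine h.mono (by simp) Set.Subset.rfl ?_
  rintro _ ⟨⟨k, j⟩, rfl⟩
  exact Set.mem_iUnion₂.2 ⟨k, Finset.mem_univ k, j, by simp [Matrix.mul_apply, Matrix.vecMul,
    dotProduct]⟩

/-- Entries of a difference of two available matrices: one step each. [folklore] -/
theorem mba_sub {m p : Type} [Fintype m] [Fintype p] (P Q : Matrix m p K) {S : Set K}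
    (hP : ∀ i k, P i k ∈ S ∪ Set.range (algebraMap ℂ K))
    (hQ : ∀ i k, Q i k ∈ S ∪ Set.range (algebraMap ℂ K)) :
    Derivable ℂ (Fintype.card m * Fintype.card p) S
      (Set.range fun ik : m × p => (P - Q) ik.1 ik.2) := by
  rw [← Fintype.card_prod]
  refine mba_family fun ik => ?_
  have h := Derivable.lin (hP ik.1 ik.2) (hQ ik.1 ik.2) (1 : ℂ) (-1)
  rwa [one_smul, neg_one_smul, ← sub_eq_add_neg] at h

/-- Entries of the negation of an available matrix: one step each. [folklore] -/
theorem mba_neg {m p : Type} [Fintype m] [Fintype p] (P : Matrix m p K) {S : Set K}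
    (hP : ∀ i k, P i k ∈ S ∪ Set.range (algebraMap ℂ K)) :
    Derivable ℂ (Fintype.card m * Fintype.card p) S
      (Set.range fun ik : m × p => (-P) ik.1 ik.2) := by
  rw [← Fintype.card_prod]
  refine mba_family fun ik => ?_
  have h := Derivable.smul (hP ik.1 ik.2) (-1 : ℂ)
  rwa [neg_one_smul] at h

/-- The parity splitting of `Fin (2 ^ (κ+1))` into even and odd positions. [folklore] -/
theorem mba_parityEquiv (κ : ℕ) : ∃ e : Fin (2 ^ κ) ⊕ Fin (2 ^ κ) ≃ Fin (2 ^ (κ + 1)),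
    (∀ i, ((e (Sum.inl i) : Fin (2 ^ (κ + 1))) : ℕ) = 2 * i) ∧
      (∀ i, ((e (Sum.inr i) : Fin (2 ^ (κ + 1))) : ℕ) = 2 * i + 1) := by
  let f : Fin (2 ^ κ) ⊕ Fin (2 ^ κ) → Fin (2 ^ (κ + 1)) :=
    Sum.elim (fun i => ⟨2 * i, by have := i.2; rw [pow_succ]; omega⟩)
      (fun i => ⟨2 * i + 1, by have := i.2; rw [pow_succ]; omega⟩)
  have hf : Function.Injective f := by
    rintro (i | i) (j | j) h <;>
      simp only [f, Sum.elim_inl, Sum.elim_inr, Fin.mk.injEq, Sum.inl.injEq, Sum.inr.injEq,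
        reduceCtorEq] at h ⊢
    · exact Fin.ext (by omega)
    · omega
    · omega
    · exact Fin.ext (by omega)
  have hbij : Function.Bijective f :=
    (Fintype.bijective_iff_injective_and_card f).2 ⟨hf, by simp [pow_succ]; ring⟩
  exact ⟨Equiv.ofBijective f hbij, fun _ => rfl, fun _ => rfl⟩

omit [Algebra ℂ K] in
/-- Target identification along an index equivalence: determinant, `C⁻¹ G` and `Hᵀ C⁻¹` of `C`
are read off from those of `C.submatrix e e`. [folklore] -/
theorem mba_target {m n p : Type} [Fintype m] [Fintype n] [Fintype p] [DecidableEq m]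
    [DecidableEq n] (e : n ≃ m) (C : Matrix m m K) (G H : Matrix m p K) :
    ({C.det} ∪ Set.range (fun ik : m × p => (C⁻¹ * G) ik.1 ik.2) ∪
        Set.range (fun ki : p × m => (Hᵀ * C⁻¹) ki.1 ki.2)) ⊆
      ({(C.submatrix e e).det} ∪
        Set.range (fun ik : n × p => ((C.submatrix e e)⁻¹ * G.submatrix e id) ik.1 ik.2) ∪
        Set.range (fun ki : p × n => ((H.submatrix e id)ᵀ * (C.submatrix e e)⁻¹) ki.1 ki.2)) := by
  have h1 : (C.submatrix e e)⁻¹ * G.submatrix e id = (C⁻¹ * G).submatrix e id := by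
    rw [Matrix.inv_submatrix_equiv, Matrix.submatrix_mul_equiv]
  have h2 : (H.submatrix e id)ᵀ * (C.submatrix e e)⁻¹ = (Hᵀ * C⁻¹).submatrix id e := by
    rw [Matrix.inv_submatrix_equiv, Matrix.transpose_submatrix, Matrix.submatrix_mul_equiv]
  rintro x ((hx | ⟨⟨i, k⟩, rfl⟩) | ⟨⟨k, i⟩, rfl⟩)
  · left; left
    rw [Set.mem_singleton_iff] at hx ⊢
    rw [hx, Matrix.det_submatrix_equiv_self]
  · left; right
    exact ⟨(e.symm i, k), by rw [h1]; simp⟩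
  · right
    exact ⟨(k, e.symm i), by rw [h2]; simp⟩

omit [Algebra ℂ K] in
/-- Transfer of the principal-minor hypothesis along a block splitting: the leading block and its
Schur complement again have all principal minors nonzero (via the Schur determinant formula for
bordered minors, hypothesis `hminor`). [folklore] -/
theorem mba_minors {m m₁ m₂ : Type} [Fintype m] [Fintype m₁] [Fintype m₂] [DecidableEq m]
    [DecidableEq m₁] [DecidableEq m₂]
    (hminor : ∀ (m₁ m₂ ι : Type) [Fintype m₁] [Fintype m₂] [Fintype ι] [DecidableEq m₁]
        [DecidableEq m₂] [DecidableEq ι] (M : Matrix (m₁ ⊕ m₂) (m₁ ⊕ m₂) K) (g : ι → m₂),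
        IsUnit M.toBlocks₁₁.det →
        (M.submatrix (Sum.map id g) (Sum.map id g)).det =
          M.toBlocks₁₁.det *
            ((M.toBlocks₂₂ - M.toBlocks₂₁ * M.toBlocks₁₁⁻¹ * M.toBlocks₁₂).submatrix g g).det)
    (C : Matrix m m K) (e : m₁ ⊕ m₂ ≃ m) (E : Matrix m₁ m₁ K) (F : Matrix m₁ m₂ K)
    (F' : Matrix m₂ m₁ K) (D : Matrix m₂ m₂ K)
    (hM : C.submatrix e e = Matrix.fromBlocks E F F' D)
    (hmin : ∀ (ι : Type) [Fintype ι] [DecidableEq ι] (g : ι → m), Function.Injective g →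
      (C.submatrix g g).det ≠ 0) :
    (∀ (ι : Type) [Fintype ι] [DecidableEq ι] (g : ι → m₁), Function.Injective g →
        (E.submatrix g g).det ≠ 0) ∧
      (∀ (ι : Type) [Fintype ι] [DecidableEq ι] (g : ι → m₂), Function.Injective g →
        ((D - F' * E⁻¹ * F).submatrix g g).det ≠ 0) := by
  have hE : ∀ (ι : Type) [Fintype ι] [DecidableEq ι] (g : ι → m₁), Function.Injective g →
      (E.submatrix g g).det ≠ 0 := by
    intro ι _ _ g hg
    have h := hmin ι (e ∘ Sum.inl ∘ g) (e.injective.comp (Sum.inl_injective.comp hg))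
    have h' : C.submatrix (e ∘ Sum.inl ∘ g) (e ∘ Sum.inl ∘ g) = E.submatrix g g := by
      rw [show (⇑e ∘ Sum.inl ∘ g) = ⇑e ∘ (Sum.inl ∘ g) from rfl, ← Matrix.submatrix_submatrix, hM]
      ext i j
      simp
    rwa [h'] at h
  refine ⟨hE, fun ι _ _ g hg => ?_⟩
  have hunit : IsUnit (Matrix.fromBlocks E F F' D).toBlocks₁₁.det := by
    rw [Matrix.toBlocks_fromBlocks₁₁]
    exact isUnit_iff_ne_zero.2 (by simpa using hE m₁ id Function.injective_id)
  have h := hminor m₁ m₂ ι (Matrix.fromBlocks E F F' D) g hunit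
  simp only [Matrix.toBlocks_fromBlocks₁₁, Matrix.toBlocks_fromBlocks₁₂,
    Matrix.toBlocks_fromBlocks₂₁, Matrix.toBlocks_fromBlocks₂₂] at h
  have h' := hmin (m₁ ⊕ ι) (e ∘ Sum.map id g)
    (e.injective.comp (Function.injective_id.sumMap hg))
  rw [← Matrix.submatrix_submatrix, hM, h] at h'
  exact right_ne_zero_of_mul h'

/-- The elementary cost inequality of the recursion:
`2·X(κ) + 12 α² (κ+4) 2^κ + 4 α 2^κ + 1 ≤ X(κ+1)` for `X(κ) = 64 (α+1)² (κ+1)² 2^κ`. [folklore] -/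
theorem mba_cost (α κ : ℕ) :
    64 * (α + 1) ^ 2 * (κ + 1) ^ 2 * 2 ^ κ +
        (64 * (α + 1) ^ 2 * (κ + 1) ^ 2 * 2 ^ κ +
          6 * (α * (2 ^ κ * α + α * (2 * κ + 7) * 2 ^ κ)) +
          4 * (2 ^ κ * α) + 1) ≤
      64 * (α + 1) ^ 2 * (κ + 1 + 1) ^ 2 * 2 ^ (κ + 1) := by
  obtain ⟨t, ht⟩ : ∃ t : ℕ, 2 ^ κ = t + 1 :=
    ⟨2 ^ κ - 1, by have := Nat.one_le_two_pow (n := κ); omega⟩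
  have h2 : (2 : ℕ) ^ (κ + 1) = 2 ^ κ * 2 := pow_succ 2 κ
  rw [h2, ht]
  calc _ ≤ _ + (244 * α ^ 2 * κ * t + 244 * α ^ 2 * κ + 336 * α ^ 2 * t + 336 * α ^ 2 +
        512 * α * κ * t + 512 * α * κ + 764 * α * t + 764 * α + 256 * κ * t + 256 * κ +
        384 * t + 383) := Nat.le_add_right _ _
    _ = _ := by ring

/-- **Abstract Bitmead–Anderson assembly step.** Given the outputs of the recursion on the leading
block `E` (its determinant and the generators `E⁻¹ G₁`, `H₁ᵀ E⁻¹` of its inverse, all in `S₁`),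
fast matrix–vector products with `F`, `F'`, `E⁻¹` (cost `c` each, hypothesis `hops`), a recursive
solver for the Schur complement in generator form (cost `X`, hypothesis `hrec`) and the
block-inverse action formulas (`hbY`, `hbW`), the determinant `det E · det S` and the generators
of the inverse of the full block matrix are derivable at cost `X + 6αc + 4tα + 1`.
[cite: BitmeadAnderson1980, §3–4] -/
theorem mba_assemble {m p : Type} [Fintype m] [Fintype p] [DecidableEq m] [DecidableEq p]
    (E F F' D : Matrix m m K) (G₁ H₁ G₂ H₂ : Matrix m p K) (S₁ : Set K) (c X : ℕ)
    (hG₂ : ∀ i k, G₂ i k ∈ S₁ ∪ Set.range (algebraMap ℂ K))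
    (hH₂ : ∀ i k, H₂ i k ∈ S₁ ∪ Set.range (algebraMap ℂ K))
    (hdE : E.det ∈ S₁ ∪ Set.range (algebraMap ℂ K))
    (hY₁ : ∀ i k, (E⁻¹ * G₁) i k ∈ S₁ ∪ Set.range (algebraMap ℂ K))
    (hW₁ : ∀ k i, (H₁ᵀ * E⁻¹) k i ∈ S₁ ∪ Set.range (algebraMap ℂ K))
    (hops : ∀ S : Set K, S₁ ⊆ S → ∀ v : m → K,
      (∀ i, v i ∈ S ∪ Set.range (algebraMap ℂ K)) →
      (Derivable ℂ c S (Set.range (F.mulVec v)) ∧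
          Derivable ℂ c S (Set.range (Matrix.vecMul v F))) ∧
        (Derivable ℂ c S (Set.range (F'.mulVec v)) ∧
          Derivable ℂ c S (Set.range (Matrix.vecMul v F'))) ∧
        (Derivable ℂ c S (Set.range (Matrix.mulVec E⁻¹ v)) ∧
          Derivable ℂ c S (Set.range (Matrix.vecMul v E⁻¹))))
    (hrec : ∀ S : Set K, S₁ ⊆ S →
      (∀ i k, (G₂ - F' * (E⁻¹ * G₁)) i k ∈ S ∪ Set.range (algebraMap ℂ K)) →
      (∀ j k, (H₂ - (E⁻¹ * F)ᵀ * H₁) j k ∈ S ∪ Set.range (algebraMap ℂ K)) →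
      Derivable ℂ X S ({(D - F' * E⁻¹ * F).det} ∪
        Set.range (fun ik : m × p =>
          ((D - F' * E⁻¹ * F)⁻¹ * (G₂ - F' * (E⁻¹ * G₁))) ik.1 ik.2) ∪
        Set.range (fun kj : p × m =>
          ((H₂ - (E⁻¹ * F)ᵀ * H₁)ᵀ * (D - F' * E⁻¹ * F)⁻¹) kj.1 kj.2)))
    (hbY : (Matrix.fromBlocks E F F' D)⁻¹ * Matrix.fromRows G₁ G₂ =
      Matrix.fromRows (E⁻¹ * G₁ - E⁻¹ * (F * ((D - F' * E⁻¹ * F)⁻¹ * (G₂ - F' * (E⁻¹ * G₁)))))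
        ((D - F' * E⁻¹ * F)⁻¹ * (G₂ - F' * (E⁻¹ * G₁))))
    (hbW : (Matrix.fromRows H₁ H₂)ᵀ * (Matrix.fromBlocks E F F' D)⁻¹ =
      Matrix.fromCols
        (H₁ᵀ * E⁻¹ - (((H₂ᵀ - (H₁ᵀ * E⁻¹) * F) * (D - F' * E⁻¹ * F)⁻¹) * F') * E⁻¹)
        ((H₂ᵀ - (H₁ᵀ * E⁻¹) * F) * (D - F' * E⁻¹ * F)⁻¹)) :
    Derivable ℂ (X + 6 * (Fintype.card p * c) + 4 * (Fintype.card m * Fintype.card p) + 1) S₁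
      ({E.det * (D - F' * E⁻¹ * F).det} ∪
        Set.range (fun ik : (m ⊕ m) × p =>
          ((Matrix.fromBlocks E F F' D)⁻¹ * Matrix.fromRows G₁ G₂) ik.1 ik.2) ∪
        Set.range (fun ki : p × (m ⊕ m) =>
          ((Matrix.fromRows H₁ H₂)ᵀ * (Matrix.fromBlocks E F F' D)⁻¹) ki.1 ki.2)) := by
  set Y₁ : Matrix m p K := E⁻¹ * G₁ with hY₁def
  set W₁ : Matrix p m K := H₁ᵀ * E⁻¹ with hW₁def
  set Sc : Matrix m m K := D - F' * E⁻¹ * F with hScdef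
  set Gt : Matrix m p K := G₂ - F' * Y₁ with hGtdef
  set Ht : Matrix m p K := H₂ - (E⁻¹ * F)ᵀ * H₁ with hHtdef
  have hHtT : Htᵀ = H₂ᵀ - W₁ * F := by
    simp [hHtdef, hW₁def, Matrix.transpose_sub, Matrix.transpose_mul, Matrix.mul_assoc]
  have hTF : (E⁻¹ * F)ᵀ * H₁ = (W₁ * F)ᵀ := by
    simp [hW₁def, Matrix.transpose_mul, Matrix.mul_assoc]
  rw [← hHtT] at hbW
  set YS : Matrix m p K := Sc⁻¹ * Gt with hYSdef
  set WS : Matrix p m K := Htᵀ * Sc⁻¹ with hWSdef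
  -- Stage 1: `F' * Y₁` and `W₁ * F`.
  have st1 : Derivable ℂ (Fintype.card p * c + Fintype.card p * c) S₁
      (Set.range (fun ik : m × p => (F' * Y₁) ik.1 ik.2) ∪
        Set.range (fun kj : p × m => (W₁ * F) kj.1 kj.2)) :=
    (mba_mulRight F' Y₁ (fun v hv => (hops S₁ Set.Subset.rfl v hv).2.1.1) hY₁).union
      (mba_mulLeft W₁ F (fun v hv => (hops S₁ Set.Subset.rfl v hv).1.2) hW₁)
  -- Stage 2: the generators `Gt`, `Ht` of the Schur complement.
  have st2 : Derivable ℂ (Fintype.card m * Fintype.card p + Fintype.card m * Fintype.card p)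
      (S₁ ∪ (Set.range (fun ik : m × p => (F' * Y₁) ik.1 ik.2) ∪
        Set.range (fun kj : p × m => (W₁ * F) kj.1 kj.2)))
      (Set.range (fun ik : m × p => Gt ik.1 ik.2) ∪ Set.range (fun ik : m × p => Ht ik.1 ik.2)) :=
    (mba_sub G₂ (F' * Y₁) (fun i k => (hG₂ i k).imp_left Or.inl)
        (fun i k => Or.inl (Or.inr (Or.inl ⟨(i, k), rfl⟩)))).union
      (mba_sub H₂ ((E⁻¹ * F)ᵀ * H₁) (fun i k => (hH₂ i k).imp_left Or.inl)
        (fun j k => Or.inl (Or.inr (Or.inr ⟨(k, j), by rw [hTF]; rfl⟩))))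
  have st12 := mba_snoc st1 st2
  -- Stage 3: recursion on the Schur complement.
  have st3 := hrec _
    (Set.subset_union_left
      (t := (Set.range (fun ik : m × p => (F' * Y₁) ik.1 ik.2) ∪
          Set.range (fun kj : p × m => (W₁ * F) kj.1 kj.2)) ∪
        (Set.range (fun ik : m × p => Gt ik.1 ik.2) ∪
          Set.range (fun ik : m × p => Ht ik.1 ik.2))))
    (fun i k => Or.inl (Or.inr (Or.inr (Or.inl ⟨(i, k), rfl⟩))))
    (fun j k => Or.inl (Or.inr (Or.inr (Or.inr ⟨(j, k), rfl⟩))))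
  have st123 := mba_snoc st12 st3
  -- Stage 4: `F * YS` and `WS * F'`.
  set U3 : Set K := Set.range (fun ik : m × p => (F' * Y₁) ik.1 ik.2) ∪
        Set.range (fun kj : p × m => (W₁ * F) kj.1 kj.2) ∪
      (Set.range (fun ik : m × p => Gt ik.1 ik.2) ∪ Set.range (fun ik : m × p => Ht ik.1 ik.2)) ∪
      ({Sc.det} ∪ Set.range (fun ik : m × p => YS ik.1 ik.2) ∪
        Set.range (fun kj : p × m => WS kj.1 kj.2)) with hU3
  have hS₃ : S₁ ⊆ S₁ ∪ U3 := Set.subset_union_left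
  have hYS : ∀ i k, YS i k ∈ S₁ ∪ U3 ∪ Set.range (algebraMap ℂ K) := fun i k =>
    Or.inl (Or.inr (Or.inr (Or.inl (Or.inr ⟨(i, k), rfl⟩))))
  have hWS : ∀ k j, WS k j ∈ S₁ ∪ U3 ∪ Set.range (algebraMap ℂ K) := fun k j =>
    Or.inl (Or.inr (Or.inr (Or.inr ⟨(k, j), rfl⟩)))
  have st4 : Derivable ℂ (Fintype.card p * c + Fintype.card p * c) (S₁ ∪ U3)
      (Set.range (fun ik : m × p => (F * YS) ik.1 ik.2) ∪
        Set.range (fun kj : p × m => (WS * F') kj.1 kj.2)) :=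
    (mba_mulRight F YS (fun v hv => (hops _ hS₃ v hv).1.1) hYS).union
      (mba_mulLeft WS F' (fun v hv => (hops _ hS₃ v hv).2.1.2) hWS)
  have st1234 := mba_snoc st123 st4
  -- Stage 5: `E⁻¹ * (F * YS)` and `(WS * F') * E⁻¹`.
  set U4 : Set K := U3 ∪ (Set.range (fun ik : m × p => (F * YS) ik.1 ik.2) ∪
        Set.range (fun kj : p × m => (WS * F') kj.1 kj.2)) with hU4
  have hS₄ : S₁ ⊆ S₁ ∪ U4 := Set.subset_union_left
  have st5 : Derivable ℂ (Fintype.card p * c + Fintype.card p * c) (S₁ ∪ U4)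
      (Set.range (fun ik : m × p => (E⁻¹ * (F * YS)) ik.1 ik.2) ∪
        Set.range (fun kj : p × m => (WS * F' * E⁻¹) kj.1 kj.2)) :=
    (mba_mulRight E⁻¹ (F * YS) (fun v hv => (hops _ hS₄ v hv).2.2.1)
        (fun i k => Or.inl (Or.inr (Or.inr (Or.inl ⟨(i, k), rfl⟩))))).union
      (mba_mulLeft (WS * F') E⁻¹ (fun v hv => (hops _ hS₄ v hv).2.2.2)
        (fun k j => Or.inl (Or.inr (Or.inr (Or.inr ⟨(k, j), rfl⟩)))))
  have st12345 := mba_snoc st1234 st5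
  -- Stage 6: the final differences and `det E * det Sc`.
  set U5 : Set K := U4 ∪ (Set.range (fun ik : m × p => (E⁻¹ * (F * YS)) ik.1 ik.2) ∪
        Set.range (fun kj : p × m => (WS * F' * E⁻¹) kj.1 kj.2)) with hU5
  have st6 : Derivable ℂ (Fintype.card m * Fintype.card p + Fintype.card p * Fintype.card m + 1)
      (S₁ ∪ U5)
      (Set.range (fun ik : m × p => (Y₁ - E⁻¹ * (F * YS)) ik.1 ik.2) ∪
        Set.range (fun kj : p × m => (W₁ - WS * F' * E⁻¹) kj.1 kj.2) ∪ {E.det * Sc.det}) :=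
    ((mba_sub Y₁ (E⁻¹ * (F * YS)) (fun i k => (hY₁ i k).imp_left Or.inl)
        (fun i k => Or.inl (Or.inr (Or.inr (Or.inl ⟨(i, k), rfl⟩))))).union
      (mba_sub W₁ (WS * F' * E⁻¹) (fun k i => (hW₁ k i).imp_left Or.inl)
        (fun k i => Or.inl (Or.inr (Or.inr (Or.inr ⟨(k, i), rfl⟩)))))).union
      (Derivable.mul (hdE.imp_left Or.inl)
        (Or.inl (Or.inr (Or.inl (Or.inl (Or.inr (Or.inl (Or.inl rfl))))))))
  have hfin := mba_snoc st12345 st6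
  refine hfin.mono ?_ Set.Subset.rfl ?_
  · have := Nat.mul_comm (Fintype.card p) (Fintype.card m)
    omega
  · rintro x ((hx | ⟨⟨s, k⟩, rfl⟩) | ⟨⟨k, s⟩, rfl⟩)
    · exact Or.inr (Or.inr hx)
    · dsimp only
      rw [hbY]
      rcases s with i | i
      · rw [Matrix.fromRows_apply_inl]
        exact Or.inr (Or.inl (Or.inl ⟨(i, k), rfl⟩))
      · rw [Matrix.fromRows_apply_inr]
        exact Or.inl (Or.inl (Or.inl (Or.inr (Or.inl (Or.inr ⟨(i, k), rfl⟩)))))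
    · dsimp only
      rw [hbW]
      rcases s with i | i
      · rw [Matrix.fromCols_apply_inl]
        exact Or.inr (Or.inl (Or.inr ⟨(k, i), rfl⟩))
      · rw [Matrix.fromCols_apply_inr]
        exact Or.inl (Or.inl (Or.inl (Or.inr (Or.inr ⟨(k, i), rfl⟩))))

end KLevel

end

end Summit.MatrixMultiplication.MatrixMultiplication.Theorems
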